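import Summits.QuantumFields.BalabanUV.Beta.GAN24.AveragedPropagatorOneStepSup
import Summits.QuantumFields.BalabanUV.Beta.GAN24.Entry115SupCubic
import Summits.QuantumFields.BalabanUV.Beta.GAN24.Entry112SupLogCubicFlat
import Literature.MathematicalPhysics.QuantumFieldTheory.Balaban1983to89.B5G115SupBound
import Summits.QuantumFields.BalabanUV.T4Continuum.Support.BalabanAveragedCoercive

/-!
# G-an2-4 ∕ (CONV-C), road P2, route R2-S1, VECTOR LAYER, PART 6 — THE ONE-STEP SUP LAW OF BAŁABAN's AVERAGED PROPAGATOR `Q_k𝒢_kQ_k*`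
# AT `U = 1`, `a = 1`, ON EVERY CUBIC UNIT TORUS, UNCONDITIONAL:
# `|((c_{RN} − c_N)g)(y)| ≤ K(d)·((R−1)∕(RN))·(2 + log(RN) + log N)·|g|_∞`, every `N, R, N₀ ≥ 1`, every `d`

Unit `b2b-balaban-gan24-p2` (gen 30), BINDER row G-an2-4 ∕ (CONV-C), road P2; crux team (2).  Part 5's END
(`AveragedPropagatorOneStepSup.norm_covOp_succ_sub_mulVec_le_of_letters`) displays the five vector sup letters of `𝒢 = Δ_a⁻¹`; at `a = 1` on
cubic tori they are THEOREMS OF THE TREE: the zeroth `B5G115SupBound.norm_DeltaA_one_inv_mulVec_le_global` (lit-balaban pv15; every torus),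
the first-order `Entry115SupCubic.norm_inv_fdiffH_mulVec_le_cubic` ∕ `norm_fdiff_inv_mulVec_le_cubic` and the second-order-with-log
`Entry112SupLogCubicFlat.sup112GDivDiv_one_cubic` ∕ `sup112GradGrad_one_cubic` (G-an2-4 swarm leaf-04 ∕ leaf-03 ∕ leaf-01 over NE3's
`Entry110*Cubic` analysis).  THIS FILE plugs them in BY NAME:
 * §0 DICTIONARY with the NE2 lineage: **`covOp_eq_covB`** — `covOp n M a = B5QGQ171Unit.covB n hn M a ha` (`= n^d•Q_k𝒢Q_kᴴ`, the object whose
   operator-norm tower rate and coercivity `BalabanAveragedCoercive.coercive_covB'` NE2-P1 proved); hence **`coercive_covOp`**;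
 * **`norm_covOp_succ_sub_mulVec_le_cubic`** — `∃ K > 0` (a function of `d`) such that for all `N, R, N₀ ≥ 1`, every unit bond field `g` with
   `|g| ≤ b` and every unit bond `i` of the cubic unit torus `Π_{μ<d+1} ℤ∕N₀`:
   `‖((c_{RN}(1) − c_N(1))g)(i)‖ ≤ K·((R−1)∕(RN))·(2 + log(RN) + log N)·b`, `c_n(1) = QvOp n T * (DeltaA n T 1)⁻¹ * QvAdj n T`.
READING.  `c_n` is Bałaban's `Q_kG_kQ_k*` ([Balaban1984PropagatorsI] (1.99); the denominator of `H_k` (2.35); NE2's `covB` up to `n^d`); with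
`N = L^k`, `R = L` the law reads `≤ K′·k·L^{−k}·|g|_∞` — the (CONV-C) one-step RATE clause for this VECTOR unit-lattice constituent in sup → sup
currency at the strong exponent (up to the genuine `log`), by a position-space argument in which the non-local gauge projection `P` of `Δ_a` never
had to be estimated (Part 3's gauge collapse).  The DECAY clause, the kernel (entrywise with `e^{−δ|y−y′|}`) currency, the inverse `(Q𝒢Q*)⁻¹` and the
tower packaging are NOT in this file.
HONEST SCOPE.  Junction (`obtain` + arithmetic); `U = 1`, `a = 1`, CUBIC unit tori, the unit-lattice-read constituent only; constants EXISTENTIAL in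
`d` (the suppliers'); nothing of Bałaban's asserted — (1.99), (1.110)∕(1.115) pp. 35–36 are TEXT LOCATIONS; the `log` letters and this law are OURS.
NOT (CONV-C) as typed, NEVER «G-an2-4 closed», NOT NE2, NOT D1, NOT BetaPertH, NOT continuum, NOT Clay; not in print — our proof.  HONEST DEPENDENCY:
continuum YM on T⁴ ⇐ BetaPertH ∧ nine spine estimates (0/9 proved); BetaPertH ⇐ (D1) ∧ (D4) ∧ CAP+tail; G-an2-4 gates asym, D1 and NE2/3/4.
-/

noncomputable section

open scoped BigOperators ComplexConjugate Matrix

namespace Summit.QuantumFields.BalabanUV.Beta.GAN24.AveragedPropagatorOneStepCubic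

open Literature.MathematicalPhysics.QuantumFieldTheory.Balaban1983to89
open B5Prop11Plancherel (Tor fine fdiff)
open B5DeltaA169 (DeltaA QvAdj calG_eq_DeltaA_inv)
open B5QGQ171Unit (covB)
open B5G115SupBound (norm_DeltaA_one_inv_mulVec_le_global)
open Summit.QuantumFields.BalabanUV.T4Continuum.CoerciveInverseTower (Coercive)
open Summit.QuantumFields.BalabanUV.T4Continuum.BalabanAveragedCoercive (gammaB coercive_covB')
open Summit.QuantumFields.BalabanUV.Beta.GAN24.StaircaseAveragingDefect (ratio_nonneg)
open Summit.QuantumFields.BalabanUV.Beta.GAN24.AveragedPropagatorTwoLevel (covOp)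
open Summit.QuantumFields.BalabanUV.Beta.GAN24.AveragedPropagatorOneStepSup (norm_covOp_succ_sub_mulVec_le_of_letters)
open Summit.QuantumFields.BalabanUV.Beta.GAN24.Entry115SupCubic (norm_fdiff_inv_mulVec_le_cubic norm_inv_fdiffH_mulVec_le_cubic)
open Summit.QuantumFields.BalabanUV.Beta.GAN24.Entry112SupLogCubicFlat (sup112GradGrad_one_cubic sup112GDivDiv_one_cubic)

/-! ## §0 Dictionary with the NE2 lineage -/

section Dictionary

variable {d : ℕ} (n : ℕ) [NeZero n] (hn : 1 ≤ n) (M : Fin d → ℕ) [hM : ∀ μ, NeZero (M μ)] (a : ℝ) (ha : 0 < a)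

include hn ha in
/-- **`covOp = covB`**: road P2's `Q·(Δ_a)⁻¹·Q*` IS NE2's `n^d•Q·𝒢·Qᴴ` (`B5QGQ171Unit.covB`; `Q* = n^d•Qᴴ`, `𝒢 = calG = (Δ_a)⁻¹`). [folklore] -/
theorem covOp_eq_covB : covOp n M a = covB n hn M a ha := by
  rw [covOp, covB, QvAdj, calG_eq_DeltaA_inv, Matrix.mul_smul, Matrix.mul_assoc]

include hn ha in
/-- hence `covOp` is uniformly COERCIVE: `γ_B(d,a)·|B|² ≤ Re⟨B, c_n(a)B⟩`, `γ_B` NE2-P1's constant (free of `n` and of the torus). [folklore] -/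
theorem coercive_covOp : Coercive (gammaB d a) (covOp n M a) := by
  rw [covOp_eq_covB n hn M a ha]; exact coercive_covB' n hn M a ha

end Dictionary

variable (d : ℕ)

/-- the zeroth vector letter at `a = 1`, packaged: `∃ C₀ ≥ 0`, `‖(Δ_1⁻¹ F)(i)‖ ≤ C₀·sup|F|` for every `n ≥ 1` and EVERY torus in dimension `d + 1`
(`B5G115SupBound.norm_DeltaA_one_inv_mulVec_le_global` with `Nn := d`). [folklore] -/
theorem exists_sup_inv_one :
    ∃ C₀ : ℝ, 0 ≤ C₀ ∧ ∀ (n : ℕ) [NeZero n] (M : Fin (d + 1) → ℕ) [∀ μ, NeZero (M μ)]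
      (F : Tor (fine n M) × Fin (d + 1) → ℂ) (B : ℝ), (∀ j, ‖F j‖ ≤ B) → ∀ i, ‖((DeltaA n M 1)⁻¹ *ᵥ F) i‖ ≤ C₀ * B := by
  refine ⟨_, ?_, fun n _ M _ F B hF i =>
    (norm_DeltaA_one_inv_mulVec_le_global n (Nat.one_le_iff_ne_zero.mpr (NeZero.ne n)) M (Nn := d) le_rfl F hF i).trans_eq
      (mul_comm _ _)⟩
  -- nonnegativity: read the bound at the constant field `1` on the one-site torus
  have h := norm_DeltaA_one_inv_mulVec_le_global 1 le_rfl (fun _ : Fin (d + 1) => 1) (Nn := d) le_rfl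
    (fun _ => (1 : ℂ)) (B := 1) (fun _ => by simp) ((fun _ => 0), 0)
  rw [one_mul] at h
  exact (norm_nonneg _).trans h

/-- **THE ONE-STEP SUP LAW OF THE AVERAGED PROPAGATOR `Q_k𝒢_kQ_k*` AT `U = 1`, `a = 1`, ON CUBIC UNIT TORI — UNCONDITIONAL**: `∃ K > 0` (a function
of `d`) such that for all `N, R, N₀ ≥ 1`, every unit bond field `g` with `|g| ≤ b` and every unit bond `i`,
`‖((c_{RN} − c_N)g)(i)‖ ≤ K·((R−1)∕(RN))·(2 + log(RN) + log N)·b`. [folklore] -/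
theorem norm_covOp_succ_sub_mulVec_le_cubic :
    ∃ K : ℝ, 0 < K ∧ ∀ (N R N₀ : ℕ) [NeZero N] [NeZero R] [NeZero N₀]
      (g : Tor (fun _ : Fin (d + 1) => N₀) × Fin (d + 1) → ℂ) (b : ℝ), (∀ j, ‖g j‖ ≤ b) →
        ∀ i : Tor (fun _ : Fin (d + 1) => N₀) × Fin (d + 1),
          ‖((covOp (R * N) (fun _ : Fin (d + 1) => N₀) 1 - covOp N (fun _ : Fin (d + 1) => N₀) 1) *ᵥ g) i‖
            ≤ K * (((R : ℝ) - 1) / ((R : ℝ) * N)) * (2 + Real.log ((R * N : ℕ) : ℝ) + Real.log (N : ℝ)) * b := by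
  obtain ⟨C₀, hC₀, h0⟩ := exists_sup_inv_one d
  obtain ⟨C₁, hC₁, h1⟩ := norm_inv_fdiffH_mulVec_le_cubic (d := d)
  obtain ⟨C₂, hC₂, h2⟩ := norm_fdiff_inv_mulVec_le_cubic (d := d)
  obtain ⟨C₃, hC₃, h3⟩ := sup112GDivDiv_one_cubic (d := d)
  obtain ⟨C₄, hC₄, h4⟩ := sup112GradGrad_one_cubic (d := d)
  refine ⟨3 * C₀ + 3 * (C₀ * C₀) + (((d + 1 : ℕ) : ℝ) + ((d + 1 : ℕ) : ℝ) ^ 2) * (C₃ * C₂ + C₁ * C₄) + 1, by positivity, ?_⟩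
  intro N R N₀ _ _ _ g b hg i
  have hN : 1 ≤ N := Nat.one_le_iff_ne_zero.mpr (NeZero.ne N)
  have hRN : 1 ≤ R * N := Nat.one_le_iff_ne_zero.mpr (NeZero.ne (R * N))
  have hlN : 0 ≤ Real.log (N : ℝ) := Real.log_nonneg (by exact_mod_cast hN)
  have hlRN : 0 ≤ Real.log ((R * N : ℕ) : ℝ) := Real.log_nonneg (by exact_mod_cast hRN)
  have hb : 0 ≤ b := (norm_nonneg _).trans (hg i)
  have hρ := ratio_nonneg N R
  -- Part 5's END with the tree's letters
  have key := norm_covOp_succ_sub_mulVec_le_of_letters N R (fun _ : Fin (d + 1) => N₀) one_pos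
    (C₀ := C₀) (C₀' := C₀) (C₁' := C₁) (C₂ := C₂) (C₃' := C₃ * (1 + Real.log ((R * N : ℕ) : ℝ))) (C₄ := C₄ * (1 + Real.log (N : ℝ)))
    (fun F B hF j => h0 N _ F B hF j) (fun F B hF j => h0 (R * N) _ F B hF j)
    (fun ν F B hF j => h1 (R * N) N₀ ν F B hF j) (fun ν F B hF j => h2 N N₀ ν F B hF j)
    (fun μ ν F B hF j => h3 (R * N) N₀ hRN μ ν F B hF j) (fun μ ν F B hF j => h4 N N₀ hN μ ν F B hF j) g b hg i
  -- constants: `2C₀ + C₀ + (D + D²)(C₃(1+log RN)C₂ + C₁C₄(1+log N)) + 3C₀² ≤ K·(2 + log RN + log N)`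
  have hℓ1 : 1 ≤ 2 + Real.log ((R * N : ℕ) : ℝ) + Real.log (N : ℝ) := by linarith
  have hDD : 0 ≤ ((d + 1 : ℕ) : ℝ) + ((d + 1 : ℕ) : ℝ) ^ 2 := by positivity
  have e1 : C₃ * (1 + Real.log ((R * N : ℕ) : ℝ)) * C₂ ≤ C₃ * C₂ * (2 + Real.log ((R * N : ℕ) : ℝ) + Real.log (N : ℝ)) := by
    rw [mul_right_comm]; exact mul_le_mul_of_nonneg_left (by linarith) (by positivity)
  have e2 : C₁ * (C₄ * (1 + Real.log (N : ℝ))) ≤ C₁ * C₄ * (2 + Real.log ((R * N : ℕ) : ℝ) + Real.log (N : ℝ)) := by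
    rw [← mul_assoc]; exact mul_le_mul_of_nonneg_left (by linarith) (by positivity)
  have hX : 2 * C₀ + C₀ + (((d + 1 : ℕ) : ℝ) + ((d + 1 : ℕ) : ℝ) ^ 2)
        * (C₃ * (1 + Real.log ((R * N : ℕ) : ℝ)) * C₂ + C₁ * (C₄ * (1 + Real.log (N : ℝ)))) + 3 * 1 * (C₀ * C₀)
      ≤ (3 * C₀ + 3 * (C₀ * C₀) + (((d + 1 : ℕ) : ℝ) + ((d + 1 : ℕ) : ℝ) ^ 2) * (C₃ * C₂ + C₁ * C₄) + 1)
        * (2 + Real.log ((R * N : ℕ) : ℝ) + Real.log (N : ℝ)) := by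
    have h3C : 2 * C₀ + C₀ + 3 * 1 * (C₀ * C₀) ≤ (3 * C₀ + 3 * (C₀ * C₀)) * (2 + Real.log ((R * N : ℕ) : ℝ) + Real.log (N : ℝ)) := by
      have : 0 ≤ 3 * C₀ + 3 * (C₀ * C₀) := by positivity
      nlinarith
    have h4C : (((d + 1 : ℕ) : ℝ) + ((d + 1 : ℕ) : ℝ) ^ 2)
          * (C₃ * (1 + Real.log ((R * N : ℕ) : ℝ)) * C₂ + C₁ * (C₄ * (1 + Real.log (N : ℝ))))
        ≤ (((d + 1 : ℕ) : ℝ) + ((d + 1 : ℕ) : ℝ) ^ 2) * ((C₃ * C₂ + C₁ * C₄) * (2 + Real.log ((R * N : ℕ) : ℝ) + Real.log (N : ℝ))) :=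
      mul_le_mul_of_nonneg_left (by rw [add_mul]; exact add_le_add e1 e2) hDD
    nlinarith
  calc _ ≤ _ := key
    _ ≤ (((R : ℝ) - 1) / ((R : ℝ) * N))
          * ((3 * C₀ + 3 * (C₀ * C₀) + (((d + 1 : ℕ) : ℝ) + ((d + 1 : ℕ) : ℝ) ^ 2) * (C₃ * C₂ + C₁ * C₄) + 1)
            * (2 + Real.log ((R * N : ℕ) : ℝ) + Real.log (N : ℝ))) * b :=
        mul_le_mul_of_nonneg_right (mul_le_mul_of_nonneg_left hX hρ) hb
    _ = _ := by ring

end Summit.QuantumFields.BalabanUV.Beta.GAN24.AveragedPropagatorOneStepCubic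

end
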